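import Mathlib
import Summits.Ventures.HodgeRepro.Tier4.Target
import Summits.Ventures.HodgeRepro.Tier4.Common.TargetBall
import Summits.Ventures.HodgeRepro.Tier4.Common.TargetCalculus
import Summits.Ventures.HodgeRepro.Tier4.Common.AutForms
import Summits.Ventures.HodgeRepro.Tier4.Common.HeckeOnForms

/-!
# Tier4/Common/TargetHecke — the Hecke translate of an Albanese lift by ONE double coset is an integer multiple
of a SINGLE translate plus a lattice constant; the Jacobians of the target see only the single translates

Blind re-derivation cell `pub-hodge-repro`, Tier 4 (README §9–§10), seat t4-typer-2 (gen 0).  Target tree path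
`lean/Summits/Ventures/HodgeRepro/Tier4/Common/TargetHecke.lean`.  Imports the FROZEN `Tier4/Target.lean`,
`Tier4/Common/TargetBall.lean` (`actM_mul`, `actM_mem_ball`, `toBallMat_mul`, `toBallMat_J`, `continuousOn_actM`),
`Tier4/Common/TargetCalculus.lean` (`heckeTranslate_term`, `jacDet_*`) and typer-1's `Tier4/Common/AutForms.lean`
(`isOpen_ball`, `isPreconnected_ball`) / `Tier4/Common/HeckeOnForms.lean` (`cstar_mul`, `IsUnitaryOf.mul`).

THE CLAIM (the lead's S11958 (ii), «checked on paper, not in Lean» — now on the kernel).  Let `a` be an Albanese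
lift for `Γ` (`IsAlbaneseLift`: holomorphic on the ball, `a(M(γ)z) − a(z) ∈ Λ` for `γ ∈ Γ`, `z` in the ball), `Γ′`
a congruence subgroup with `Γ′ ⊆ Γ`, `γ ∈ U(H)(E)` with `γ Γ′ ⊆ Γ γ` (every `γ γ′`, `γ′ ∈ Γ′`, is `δ γ` with
`δ ∈ Γ`), and `R` a system of right-coset representatives of `Γ′ γ Γ′` (`IsCosetReps Γ′ γ R`).  Then for `z` in
the ball, `a(M(r) z) − a(M(γ) z)` lies in `Λ` for every `r ∈ R` (`r = γ₁ γ γ₂`, the action is an action, and the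
equivariance of `a` twice) and is CONSTANT on the ball (a continuous map from the connected ball into the discrete
`Λ`; `IsPreconnected.constant_of_mapsTo`), so
  `heckeTranslate τ₀ C ⟨[(1, R)]⟩ a z = |R| • a (M(γ) z) + λ`   for ONE `λ ∈ Λ` and all `z` in the ball
(`heckeTranslate_coset_eq_card_smul_add`).  Consequently the `s`-coordinate of the translate is `|R|` times the
`s`-coordinate of the single translate plus a constant on the ball (`comp_heckeTranslate_coset_eq`), and the
target's Jacobian of two such coordinates is `|R| · |R′|` times the Jacobian of the single translates
(`jacDet_comp_heckeTranslate_coset`): the pairing of `P_T4` for double-coset translates is a positive-integer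
multiple of the pairing of the single translates `a ∘ M(γ)`.

Every hypothesis is one of the target's own predicates (or the standing CM-field fact `τ₀ ∘ c = conj ∘ τ₀`);
nothing here says anything about the status of the Hodge conjecture for CM abelian varieties, which is NOT
proved (HC_CM is NOT proved by anyone in this repository).
-/

set_option autoImplicit false

noncomputable section

namespace Summit.Ventures.HodgeRepro.Tier4

open Matrix Complex
open scoped ComplexConjugate

/-! ## 1. The origin is in the ball (the ball's openness and connectedness are typer-1's `isOpen_ball`,
`isPreconnected_ball` in `AutForms.lean`) -/

/-- The origin is in the ball. -/
theorem zero_mem_ball : (0 : Fin 2 → ℂ) ∈ ball := by simp [ball, nsq]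

/-! ## 2. Unitary matrices (`cstar_mul`, `IsUnitaryOf.mul` are typer-1's, `HeckeOnForms.lean`) -/

section Unitary

variable {E : Type} [Field E] (c : E ≃+* E) (H : Matrix (Fin 3) (Fin 3) E)

/-- The elements of a congruence subgroup are unitary. -/
theorem isUnitaryOf_of_mem_congruence {Γ : Set (Matrix (Fin 3) (Fin 3) E)} (hΓ : IsCongruenceSubgroup c H Γ)
    {γ : Matrix (Fin 3) (Fin 3) E} (hγ : γ ∈ Γ) : IsUnitaryOf c H γ :=
  (hΓ.2.2.2.1 hγ).1

end Unitary

/-! ## 3. The double-coset translate of an Albanese lift -/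

section Coset

variable {K : Type*} [Field K] {E : Type} [Field E] {c : E ≃+* E} {H : Matrix (Fin 3) (Fin 3) E}
  {τ₀ : E →+* ℂ} {C : Matrix (Fin 3) (Fin 3) ℂ} (hτ : ∀ x, τ₀ (c x) = conj (τ₀ x))
  (hC : IsSylvester (H.map τ₀) C)
  {Γ Γ' : Set (Matrix (Fin 3) (Fin 3) E)} (hΓ : IsCongruenceSubgroup c H Γ) (hΓ' : IsCongruenceSubgroup c H Γ')
  (hsub : Γ' ⊆ Γ)
  {T : Finset (K →+* ℂ)} {Λ : Submodule ℤ (↥T → ℂ)} {a : (Fin 2 → ℂ) → (↥T → ℂ)}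
  (ha : IsAlbaneseLift T Λ τ₀ C Γ a)

include hτ hC hΓ in
/-- The transfer of an element of `Γ` lies in `U(2,1)`. -/
theorem toBallMat_J_of_mem {γ : Matrix (Fin 3) (Fin 3) E} (hγ : γ ∈ Γ) :
    (toBallMat τ₀ C γ)ᴴ * J * toBallMat τ₀ C γ = J :=
  toBallMat_J τ₀ c hτ hC (isUnitaryOf_of_mem_congruence c H hΓ hγ)

include ha in
/-- The equivariance of the lift, with the lattice vector named: `a (M(δ) w) − a w ∈ Λ` for `δ ∈ Γ`, `w` in the
ball. -/
theorem sub_mem_of_mem {δ : Matrix (Fin 3) (Fin 3) E} (hδ : δ ∈ Γ) {w : Fin 2 → ℂ} (hw : w ∈ ball) :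
    a (actM (toBallMat τ₀ C δ) w) - a w ∈ Λ :=
  ha.2.1 δ hδ w hw

include hτ hC hΓ hΓ' hsub ha in
/-- **The difference of a representative's translate and the single translate is a lattice vector**: for
`r = γ₁ γ γ₂` with `γ₁, γ₂ ∈ Γ′`, `γ ∈ U(H)`, `γ Γ′ ⊆ Γ γ` and `z` in the ball,
`a (M(r) z) − a (M(γ) z) ∈ Λ`. -/
theorem rep_translate_sub_mem {γ : Matrix (Fin 3) (Fin 3) E} (hγu : IsUnitaryOf c H γ)
    (hconj : ∀ γ' ∈ Γ', ∃ δ ∈ Γ, γ * γ' = δ * γ) {γ₁ γ₂ : Matrix (Fin 3) (Fin 3) E} (h₁ : γ₁ ∈ Γ')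
    (h₂ : γ₂ ∈ Γ') {z : Fin 2 → ℂ} (hz : z ∈ ball) :
    a (actM (toBallMat τ₀ C (γ₁ * γ * γ₂)) z) - a (actM (toBallMat τ₀ C γ) z) ∈ Λ := by
  have hCu : IsUnit C := hC.1
  obtain ⟨δ, hδ, hδγ⟩ := hconj γ₂ h₂
  have hγJ : (toBallMat τ₀ C γ)ᴴ * J * toBallMat τ₀ C γ = J := toBallMat_J τ₀ c hτ hC hγu
  have hδJ := toBallMat_J_of_mem hτ hC hΓ hδ
  -- the point `w = M(γ) z` and `w' = M(δ) w` lie in the ball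
  set w := actM (toBallMat τ₀ C γ) z with hw_def
  have hw : w ∈ ball := actM_mem_ball hγJ hz
  set w' := actM (toBallMat τ₀ C δ) w with hw'_def
  have hw' : w' ∈ ball := actM_mem_ball hδJ hw
  -- `M(r) z = M(γ₁) w'`
  have hr : actM (toBallMat τ₀ C (γ₁ * γ * γ₂)) z = actM (toBallMat τ₀ C γ₁) w' := by
    have hγγ₂ : IsUnitaryOf c H (γ * γ₂) := hγu.mul (isUnitaryOf_of_mem_congruence c H hΓ' h₂)
    have hJ₂ : (toBallMat τ₀ C (γ * γ₂))ᴴ * J * toBallMat τ₀ C (γ * γ₂) = J := toBallMat_J τ₀ c hτ hC hγγ₂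
    rw [Matrix.mul_assoc, toBallMat_mul τ₀ hCu, actM_mul hJ₂ hz, hδγ, toBallMat_mul τ₀ hCu, actM_mul hγJ hz]
  rw [hr]
  -- `a (M(γ₁) w') − a w' ∈ Λ` and `a w' − a w ∈ Λ`
  have e₁ : a (actM (toBallMat τ₀ C γ₁) w') - a w' ∈ Λ := sub_mem_of_mem ha (hsub h₁) hw'
  have e₂ : a w' - a w ∈ Λ := sub_mem_of_mem ha hδ hw
  have : a (actM (toBallMat τ₀ C γ₁) w') - a w =
      (a (actM (toBallMat τ₀ C γ₁) w') - a w') + (a w' - a w) := by abel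
  rw [this]
  exact Λ.add_mem e₁ e₂

include hτ hC ha in
/-- The translate `z ↦ a (M(g) z)` of a lift by a unitary `g` is continuous on the ball. -/
theorem continuousOn_translate {g : Matrix (Fin 3) (Fin 3) E} (hg : IsUnitaryOf c H g) :
    ContinuousOn (fun z => a (actM (toBallMat τ₀ C g) z)) ball := by
  have hJ := toBallMat_J τ₀ c hτ hC hg
  exact ha.1.continuousOn.comp (continuousOn_actM hJ) fun z hz => actM_mem_ball hJ hz

include hτ hC hΓ hΓ' hsub ha in
/-- **The lattice difference is constant on the ball**: for `r = γ₁ γ γ₂` as above, there is ONE `λ ∈ Λ` with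
`a (M(r) z) = a (M(γ) z) + λ` for every `z` in the ball. -/
theorem rep_translate_eq_add_const [DiscreteTopology Λ] {γ : Matrix (Fin 3) (Fin 3) E}
    (hγu : IsUnitaryOf c H γ) (hconj : ∀ γ' ∈ Γ', ∃ δ ∈ Γ, γ * γ' = δ * γ)
    {γ₁ γ₂ : Matrix (Fin 3) (Fin 3) E} (h₁ : γ₁ ∈ Γ') (h₂ : γ₂ ∈ Γ') :
    ∃ l ∈ Λ, ∀ z ∈ ball, a (actM (toBallMat τ₀ C (γ₁ * γ * γ₂)) z) = a (actM (toBallMat τ₀ C γ) z) + l := by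
  set r := γ₁ * γ * γ₂ with hr_def
  have hru : IsUnitaryOf c H r :=
    ((isUnitaryOf_of_mem_congruence c H hΓ' h₁).mul hγu).mul (isUnitaryOf_of_mem_congruence c H hΓ' h₂)
  -- the difference function
  set f : (Fin 2 → ℂ) → (↥T → ℂ) := fun z =>
    a (actM (toBallMat τ₀ C r) z) - a (actM (toBallMat τ₀ C γ) z) with hf_def
  have hfc : ContinuousOn f ball :=
    (continuousOn_translate hτ hC ha hru).sub (continuousOn_translate hτ hC ha hγu)
  have hfm : Set.MapsTo f ball (Λ : Set (↥T → ℂ)) := fun z hz =>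
    rep_translate_sub_mem hτ hC hΓ hΓ' hsub ha hγu hconj h₁ h₂ hz
  have hdisc : IsDiscrete (Λ : Set (↥T → ℂ)) := SetLike.isDiscrete_iff_discreteTopology.mpr inferInstance
  refine ⟨f 0, hfm zero_mem_ball, fun z hz => ?_⟩
  have := isPreconnected_ball.constant_of_mapsTo hdisc hfc hfm hz zero_mem_ball
  rw [← this]
  simp [f]

include hτ hC hΓ hΓ' hsub ha in
/-- **THE DOUBLE-COSET TRANSLATE IS `|R|` TIMES THE SINGLE TRANSLATE PLUS A LATTICE CONSTANT.**  For `R` a system of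
right-coset representatives of `Γ′ γ Γ′` (`IsCosetReps Γ′ γ R`), `γ ∈ U(H)` with `γ Γ′ ⊆ Γ γ`: there is `λ ∈ Λ`
with `heckeTranslate τ₀ C ⟨[(1, R)]⟩ a z = |R| • a (M(γ) z) + λ` for every `z` in the ball. -/
theorem heckeTranslate_coset_eq_card_smul_add [DiscreteTopology Λ] {γ : Matrix (Fin 3) (Fin 3) E}
    (hγu : IsUnitaryOf c H γ) (hconj : ∀ γ' ∈ Γ', ∃ δ ∈ Γ, γ * γ' = δ * γ)
    {R : Finset (Matrix (Fin 3) (Fin 3) E)} (hR : IsCosetReps Γ' γ R) :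
    ∃ l ∈ Λ, ∀ z ∈ ball,
      heckeTranslate τ₀ C ⟨[(1, R)]⟩ a z = R.card • a (actM (toBallMat τ₀ C γ) z) + l := by
  -- one lattice constant per representative
  have hrep : ∀ r ∈ R, ∃ l ∈ Λ, ∀ z ∈ ball,
      a (actM (toBallMat τ₀ C r) z) = a (actM (toBallMat τ₀ C γ) z) + l := by
    intro r hr
    obtain ⟨γ₁, h₁, γ₂, h₂, rfl⟩ := hR.1 r hr
    exact rep_translate_eq_add_const hτ hC hΓ hΓ' hsub ha hγu hconj h₁ h₂
  choose! l hl using hrep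
  refine ⟨∑ r ∈ R, l r, Λ.sum_mem fun r hr => (hl r hr).1, fun z hz => ?_⟩
  rw [heckeTranslate_term, one_smul, Finset.sum_congr rfl fun r hr => (hl r hr).2 z hz, Finset.sum_add_distrib,
    Finset.sum_const]

include hτ hC hΓ hΓ' hsub ha in
/-- The `s`-coordinate of the double-coset translate is `|R|` times the `s`-coordinate of the single translate plus a
constant, on the ball. -/
theorem comp_heckeTranslate_coset_eq [DiscreteTopology Λ] (s : K →+* ℂ) (hs : s ∈ T)
    {γ : Matrix (Fin 3) (Fin 3) E} (hγu : IsUnitaryOf c H γ) (hconj : ∀ γ' ∈ Γ', ∃ δ ∈ Γ, γ * γ' = δ * γ)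
    {R : Finset (Matrix (Fin 3) (Fin 3) E)} (hR : IsCosetReps Γ' γ R) :
    ∃ l₀ : ℂ, ∀ z ∈ ball,
      comp T s hs (heckeTranslate τ₀ C ⟨[(1, R)]⟩ a) z =
        (R.card : ℂ) * comp T s hs (fun w => a (actM (toBallMat τ₀ C γ) w)) z + l₀ := by
  obtain ⟨l, -, hl⟩ := heckeTranslate_coset_eq_card_smul_add hτ hC hΓ hΓ' hsub ha hγu hconj hR
  refine ⟨l ⟨s, hs⟩, fun z hz => ?_⟩
  show (heckeTranslate τ₀ C ⟨[(1, R)]⟩ a z) ⟨s, hs⟩ = _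
  rw [hl z hz, Pi.add_apply, Pi.smul_apply, nsmul_eq_mul]
  rfl

end Coset

/-! ## 4. The Jacobian sees only the single translates -/

section Jac

variable {u v : (Fin 2 → ℂ) → ℂ}

/-- Two functions equal on the open ball have the same `pd` at points of the ball. -/
theorem pd_congr_ball {u u' : (Fin 2 → ℂ) → ℂ} (h : ∀ z ∈ ball, u z = u' z) {z : Fin 2 → ℂ} (hz : z ∈ ball)
    (k : Fin 2) : pd k u z = pd k u' z := by
  unfold pd
  have : u =ᶠ[nhds z] u' := by
    filter_upwards [isOpen_ball.mem_nhds hz] with w hw using h w hw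
  rw [this.fderiv_eq]

/-- Two pairs of functions equal on the open ball have the same `jacDet` at points of the ball. -/
theorem jacDet_congr_ball {u u' v v' : (Fin 2 → ℂ) → ℂ} (hu : ∀ z ∈ ball, u z = u' z)
    (hv : ∀ z ∈ ball, v z = v' z) {z : Fin 2 → ℂ} (hz : z ∈ ball) : jacDet u v z = jacDet u' v' z := by
  simp only [jacDet, pd_congr_ball hu hz, pd_congr_ball hv hz]

/-- `jacDet` of `(m • u + l, m' • v + l')` (constants `l, l'`, scalars `m, m'`) is `m m'` times `jacDet u v`, at a
point where `u, v` are differentiable. -/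
theorem jacDet_const_mul_add_const (m m' l l' : ℂ) {z : Fin 2 → ℂ} (hu : DifferentiableAt ℂ u z)
    (hv : DifferentiableAt ℂ v z) :
    jacDet (fun w => m * u w + l) (fun w => m' * v w + l') z = m * m' * jacDet u v z := by
  have h1 : (fun w => m * u w + l) = fun w => (m • u) w + l := by funext w; simp
  have h2 : (fun w => m' * v w + l') = fun w => (m' • v) w + l' := by funext w; simp
  rw [h1, h2, jacDet_add_const l l' (hu.const_smul m) (hv.const_smul m'), jacDet_smul_left m hu,
    jacDet_smul_right m' hv]
  ring

/-- **The Jacobian of the target for two double-coset translates is `|R| |R′|` times the Jacobian of the single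
translates**, at points of the ball where the single translates are differentiable: the hypotheses are the two
conclusions of `comp_heckeTranslate_coset_eq` (one per corner). -/
theorem jacDet_of_coset_eqs {u u' v v' : (Fin 2 → ℂ) → ℂ} (m m' l l' : ℂ)
    (hu : ∀ z ∈ ball, u z = m * u' z + l) (hv : ∀ z ∈ ball, v z = m' * v' z + l') {z : Fin 2 → ℂ}
    (hz : z ∈ ball) (hu' : DifferentiableAt ℂ u' z) (hv' : DifferentiableAt ℂ v' z) :
    jacDet u v z = m * m' * jacDet u' v' z := by
  rw [jacDet_congr_ball hu hv hz, jacDet_const_mul_add_const m m' l l' hu' hv']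

end Jac

end Summit.Ventures.HodgeRepro.Tier4

end
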